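import Summits.KontsevichZagierPeriods.KontsevichZagierPeriods.Theorems.SoloBlindTetraDescent
import HarnessLib

/-!
# The tetrahedral descent of `B(1/12,1/4)`, IIb: semialgebraicity

`ℚ`-semialgebraicity of the domains `(-u₁,u₁)`, `(0,u₁)`, `(-u₁,0)`, `(0,u₁²)` (as lines in
`ℝ¹`) and of the integrands `E, H, H⁻, H₁, H₁⁻, G, vG, L, M` and substitution maps `μ, ν` of
the tetrahedral chain (`SoloBlindTetraPrep`, `SoloBlindTetraDescent`): rational functions with
coefficients in `ℚ(√3)` and rational powers of positive such functions
(`IsSemialgebraicFunOn.rpow_ratCast`).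
-/

noncomputable section

open Set MeasureTheory MvPolynomial

namespace Summit.KontsevichZagierPeriods.KontsevichZagierPeriods.Theorems

namespace SoloBlind

open Literature.ModelTheory.ExponentialFields (IsSemialgebraic)
open Literature.NumberTheory.Transcendental
open Literature.NumberTheory.Transcendental.KZ

/-! ## Semialgebraicity -/

/-- `line (-u₁,u₁)` is `ℚ`-semialgebraic. -/
theorem tI_sa : IsSemialgebraic ℚ (line (Ioo (-tU) tU)) :=
  isSemialgebraic_line_Ioo isAlgebraic_neg_tU isAlgebraic_tU

/-- `line (0,u₁)` is `ℚ`-semialgebraic. -/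
theorem tR_sa : IsSemialgebraic ℚ (line (Ioo (0:ℝ) tU)) :=
  isSemialgebraic_line_Ioo isAlgebraic_zero isAlgebraic_tU

/-- `line (-u₁,0)` is `ℚ`-semialgebraic. -/
theorem tLf_sa : IsSemialgebraic ℚ (line (Ioo (-tU) (0:ℝ))) :=
  isSemialgebraic_line_Ioo isAlgebraic_neg_tU isAlgebraic_zero

/-- `line (0,u₁²)` is `ℚ`-semialgebraic. -/
theorem tS_sa : IsSemialgebraic ℚ (line (Ioo (0:ℝ) (tU ^ 2))) :=
  isSemialgebraic_line_Ioo isAlgebraic_zero isAlgebraic_tU_sq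

/-- The coordinate `x ↦ x₀` is `ℚ`-semialgebraic on any `ℚ`-semialgebraic line. -/
theorem sa_coord {S : Set ℝ} (hS : IsSemialgebraic ℚ (line S)) :
    IsSemialgebraicFunOn ℚ (line S) (fun x : Fin 1 → ℝ => x 0) :=
  (isSemialgebraicFunOn_aeval hS (X 0 : MvPolynomial (Fin 1) ℚ)).congr fun x _ => by simp

/-- `E` is `ℚ`-semialgebraic on any `ℚ`-semialgebraic part of `(-u₁,u₁)`. -/
theorem sa_tetE {S : Set ℝ} (hS : IsSemialgebraic ℚ (line S)) (hsub : S ⊆ Ioo (-tU) tU) :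
    IsSemialgebraicFunOn ℚ (line S) (fun x : Fin 1 → ℝ => tetE (x 0)) := by
  have hX := sa_coord hS
  have h1 : IsSemialgebraicFunOn ℚ (line S) (fun _ : Fin 1 → ℝ => (1:ℝ)) :=
    isSemialgebraicFunOn_const_of_isAlgebraic hS isAlgebraic_one
  have hP : IsSemialgebraicFunOn ℚ (line S) (fun x : Fin 1 → ℝ => tetP (x 0)) :=
    (IsSemialgebraicFunOn.mul_holds
      (IsSemialgebraicFunOn.sub_holds (isSemialgebraicFunOn_const_of_isAlgebraic hS
        isAlgebraic_tU_sq) (IsSemialgebraicFunOn.mul_holds hX hX))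
      (IsSemialgebraicFunOn.add_holds h1 (IsSemialgebraicFunOn.mul_holds hX hX))).congr
      fun x _ => by simp only [tetP, Pi.mul_apply, Pi.sub_apply, Pi.add_apply]; ring
  refine (IsSemialgebraicFunOn.rpow_ratCast hS hP (fun x hx => tetP_pos (hsub hx))
    (-(3 / 4))).congr fun x _ => ?_
  simp only [tetE]
  norm_num

/-- `(a + b x₀) E(x₀)` is `ℚ`-semialgebraic for `a, b` algebraic. -/
theorem sa_affine_tetE {S : Set ℝ} (hS : IsSemialgebraic ℚ (line S)) (hsub : S ⊆ Ioo (-tU) tU)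
    {a b : ℝ} (ha : IsAlgebraic ℚ a) (hb : IsAlgebraic ℚ b) :
    IsSemialgebraicFunOn ℚ (line S) (fun x : Fin 1 → ℝ => (a + b * x 0) * tetE (x 0)) :=
  (IsSemialgebraicFunOn.mul_holds
    (IsSemialgebraicFunOn.add_holds (isSemialgebraicFunOn_const_of_isAlgebraic hS ha)
      (IsSemialgebraicFunOn.mul_holds (isSemialgebraicFunOn_const_of_isAlgebraic hS hb)
        (sa_coord hS)))
    (sa_tetE hS hsub)).congr fun x _ => by simp only [Pi.mul_apply, Pi.add_apply]

/-- `C₀` as an element of `K₀`. -/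
def tC0K : K₀ := ⟨tC0, mem_K₀_iff.mpr isAlgebraic_tC0⟩

/-- `u₁` as an element of `K₀`. -/
def tUK : K₀ := ⟨tU, mem_K₀_iff.mpr isAlgebraic_tU⟩

/-- `(C₀ : ℝ) = C₀`. -/
@[simp] theorem coe_tC0K : ((tC0K : K₀) : ℝ) = tC0 := rfl

/-- `(u₁ : ℝ) = u₁`. -/
@[simp] theorem coe_tUK : ((tUK : K₀) : ℝ) = tU := rfl

/-- `(√3 : ℝ) = √3`. -/
@[simp] theorem coe_r3K : ((r3K : K₀) : ℝ) = r3 := rfl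

/-- `((2 : K₀) : ℝ) = 2`. -/
@[simp] theorem coe_two_K₀ : ((2 : K₀) : ℝ) = 2 := rfl

/-- `((4 : K₀) : ℝ) = 4`. -/
@[simp] theorem coe_four_K₀ : ((4 : K₀) : ℝ) = 4 := rfl

/-- `H` is `ℚ`-semialgebraic on parts of `(-u₁,u₁)`. -/
theorem sa_tetH {S : Set ℝ} (hS : IsSemialgebraic ℚ (line S)) (hsub : S ⊆ Ioo (-tU) tU) :
    IsSemialgebraicFunOn ℚ (line S) (fun x : Fin 1 → ℝ => tetH (x 0)) :=
  (sa_affine_tetE hS hsub (a := tC0) (b := -tC0) isAlgebraic_tC0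
    (isAlgebraic_of_K₀ (-tC0K) (by simp))).congr
    fun x _ => by simp only [tetH]; ring

/-- `H⁻` is `ℚ`-semialgebraic on parts of `(-u₁,u₁)`. -/
theorem sa_tetHn {S : Set ℝ} (hS : IsSemialgebraic ℚ (line S)) (hsub : S ⊆ Ioo (-tU) tU) :
    IsSemialgebraicFunOn ℚ (line S) (fun x : Fin 1 → ℝ => tetHn (x 0)) :=
  (sa_affine_tetE hS hsub (a := tC0) (b := tC0) isAlgebraic_tC0 isAlgebraic_tC0).congr
    fun x _ => by simp only [tetHn]; ring

/-- `H₁` is `ℚ`-semialgebraic on parts of `(-u₁,u₁)`. -/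
theorem sa_tetH₁ {S : Set ℝ} (hS : IsSemialgebraic ℚ (line S)) (hsub : S ⊆ Ioo (-tU) tU) :
    IsSemialgebraicFunOn ℚ (line S) (fun x : Fin 1 → ℝ => tetH₁ (x 0)) :=
  (sa_affine_tetE hS hsub (a := tC0 * ((r3 + 1) / 2 * tU)) (b := tC0 * ((r3 + 1) / 2))
    (isAlgebraic_of_K₀ (tC0K * ((r3K + 1) / 2 * tUK)) (by simp))
    (isAlgebraic_of_K₀ (tC0K * ((r3K + 1) / 2)) (by simp))).congr
    fun x _ => by simp only [tetH₁]; ring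

/-- `H₁⁻` is `ℚ`-semialgebraic on parts of `(-u₁,u₁)`. -/
theorem sa_tetH₁n {S : Set ℝ} (hS : IsSemialgebraic ℚ (line S)) (hsub : S ⊆ Ioo (-tU) tU) :
    IsSemialgebraicFunOn ℚ (line S) (fun x : Fin 1 → ℝ => tetH₁n (x 0)) :=
  (sa_affine_tetE hS hsub (a := tC0 * ((r3 + 1) / 2 * tU)) (b := -(tC0 * ((r3 + 1) / 2)))
    (isAlgebraic_of_K₀ (tC0K * ((r3K + 1) / 2 * tUK)) (by simp))
    (isAlgebraic_of_K₀ (-(tC0K * ((r3K + 1) / 2))) (by simp))).congr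
    fun x _ => by simp only [tetH₁n]; ring

/-- `c E` is `ℚ`-semialgebraic on parts of `(-u₁,u₁)` for `c` algebraic. -/
theorem sa_const_tetE {S : Set ℝ} (hS : IsSemialgebraic ℚ (line S)) (hsub : S ⊆ Ioo (-tU) tU)
    {c : ℝ} (hc : IsAlgebraic ℚ c) :
    IsSemialgebraicFunOn ℚ (line S) (fun x : Fin 1 → ℝ => c * tetE (x 0)) :=
  (sa_affine_tetE hS hsub (a := c) (b := 0) hc isAlgebraic_zero).congr fun x _ => by simp

/-- `μ` is `ℚ`-semialgebraic on the line `(-u₁,u₁)`. -/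
theorem sa_tetMu : IsSemialgebraicFunOn ℚ (line (Ioo (-tU) tU)) (fun x : Fin 1 → ℝ => tetMu (x 0)) := by
  have hX := sa_coord tI_sa
  have c1 : IsSemialgebraicFunOn ℚ (line (Ioo (-tU) tU)) (fun _ : Fin 1 → ℝ => r3 + 1) :=
    isSemialgebraicFunOn_const_of_isAlgebraic tI_sa (isAlgebraic_of_K₀ (r3K + 1) (by push_cast; rfl))
  have c2 : IsSemialgebraicFunOn ℚ (line (Ioo (-tU) tU)) (fun _ : Fin 1 → ℝ => r3 - 1) :=
    isSemialgebraicFunOn_const_of_isAlgebraic tI_sa (isAlgebraic_of_K₀ (r3K - 1) (by push_cast; rfl))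
  have hd : IsSemialgebraicFunOn ℚ (line (Ioo (-tU) tU)) (fun x : Fin 1 → ℝ => 2 * (1 - x 0)) :=
    (isSemialgebraicFunOn_aeval tI_sa (2 * (1 - X 0) : MvPolynomial (Fin 1) ℚ)).congr
      fun x _ => by simp
  refine (IsSemialgebraicFunOn.div (IsSemialgebraicFunOn.add_holds
    (IsSemialgebraicFunOn.mul_holds c1 hX) c2) hd fun x hx => ?_).congr fun x _ => ?_
  · have hx' : x 0 < tU := (show x 0 ∈ Ioo (-tU) tU from hx).2
    have : x 0 < 1 := hx'.trans tU_lt_one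
    intro h
    have : (1 : ℝ) - x 0 = 0 := by linarith
    linarith
  · simp only [tetMu, Pi.mul_apply, Pi.add_apply]

/-- `G` is `ℚ`-semialgebraic on the line `(0,1)`. -/
theorem sa_tetG : IsSemialgebraicFunOn ℚ (line (Ioo (0:ℝ) 1)) (fun x : Fin 1 → ℝ => tetG (x 0)) := by
  have hp : IsSemialgebraicFunOn ℚ (line (Ioo (0:ℝ) 1)) (fun x : Fin 1 → ℝ => x 0 * (1 - x 0 ^ 3)) :=
    (isSemialgebraicFunOn_aeval mix_line_sa (X 0 * (1 - X 0 ^ 3) : MvPolynomial (Fin 1) ℚ)).congr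
      fun x _ => by simp
  have h3 : IsSemialgebraicFunOn ℚ (line (Ioo (0:ℝ) 1)) (fun _ : Fin 1 → ℝ => (3:ℝ)) :=
    isSemialgebraicFunOn_const_of_isAlgebraic mix_line_sa (by simpa using isAlgebraic_rat ℚ (A := ℝ) 3)
  refine (IsSemialgebraicFunOn.mul_holds h3 (IsSemialgebraicFunOn.rpow_ratCast mix_line_sa hp
    (fun x hx => ?_) (-(3 / 4)))).congr fun x _ => ?_
  · have hx' : x 0 ∈ Ioo (0:ℝ) 1 := hx
    have : x 0 ^ 3 < 1 := by
      calc x 0 ^ 3 < 1 ^ 3 := pow_lt_pow_left₀ hx'.2 hx'.1.le (by norm_num)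
        _ = 1 := by norm_num
    have : 0 < 1 - x 0 ^ 3 := by linarith
    exact mul_pos hx'.1 this
  · simp only [tetG, Pi.mul_apply]
    norm_num

/-- `v G(v)` is `ℚ`-semialgebraic on the line `(0,1)`. -/
theorem sa_tetG₁ :
    IsSemialgebraicFunOn ℚ (line (Ioo (0:ℝ) 1)) (fun x : Fin 1 → ℝ => x 0 * tetG (x 0)) :=
  (IsSemialgebraicFunOn.mul_holds (sa_coord mix_line_sa) sa_tetG).congr fun x _ => by
    simp only [Pi.mul_apply]

/-- `L` is `ℚ`-semialgebraic on the line `(0,u₁²)`. -/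
theorem sa_tetL : IsSemialgebraicFunOn ℚ (line (Ioo (0:ℝ) (tU ^ 2))) (fun x : Fin 1 → ℝ => tetL (x 0)) := by
  have hX := sa_coord tS_sa
  have h1 : IsSemialgebraicFunOn ℚ (line (Ioo (0:ℝ) (tU ^ 2))) (fun _ : Fin 1 → ℝ => (1:ℝ)) :=
    isSemialgebraicFunOn_const_of_isAlgebraic tS_sa isAlgebraic_one
  have hc : IsSemialgebraicFunOn ℚ (line (Ioo (0:ℝ) (tU ^ 2))) (fun _ : Fin 1 → ℝ => (1 / 2 : ℝ)) :=
    isSemialgebraicFunOn_const_of_isAlgebraic tS_sa (by simpa using isAlgebraic_rat ℚ (A := ℝ) (1 / 2))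
  have hq : IsSemialgebraicFunOn ℚ (line (Ioo (0:ℝ) (tU ^ 2)))
      (fun x : Fin 1 → ℝ => (tU ^ 2 - x 0) * (1 + x 0)) :=
    (IsSemialgebraicFunOn.mul_holds
      (IsSemialgebraicFunOn.sub_holds
        (isSemialgebraicFunOn_const_of_isAlgebraic tS_sa isAlgebraic_tU_sq) hX)
      (IsSemialgebraicFunOn.add_holds h1 hX)).congr fun x _ => by
        simp only [Pi.mul_apply, Pi.sub_apply, Pi.add_apply]
  have hpos : ∀ x ∈ line (Ioo (0:ℝ) (tU ^ 2)), 0 < x 0 := fun x hx =>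
    (show x 0 ∈ Ioo (0:ℝ) (tU ^ 2) from hx).1
  have hpos' : ∀ x ∈ line (Ioo (0:ℝ) (tU ^ 2)), 0 < (tU ^ 2 - x 0) * (1 + x 0) := fun x hx => by
    have hx' : x 0 ∈ Ioo (0:ℝ) (tU ^ 2) := hx
    exact mul_pos (by linarith [hx'.2]) (by linarith [hx'.1])
  refine (IsSemialgebraicFunOn.mul_holds hc (IsSemialgebraicFunOn.mul_holds
    (IsSemialgebraicFunOn.rpow_ratCast tS_sa hX hpos (-(1 / 2)))
    (IsSemialgebraicFunOn.rpow_ratCast tS_sa hq hpos' (-(3 / 4))))).congr fun x _ => ?_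
  simp only [tetL, Pi.mul_apply]
  norm_num

/-- `M` is `ℚ`-semialgebraic on the line `(0,1)`. -/
theorem sa_tetM : IsSemialgebraicFunOn ℚ (line (Ioo (0:ℝ) 1)) (fun x : Fin 1 → ℝ => tetM (x 0)) :=
  IsSemialgebraicFunOn.mul_holds
    (isSemialgebraicFunOn_const_of_isAlgebraic mix_line_sa
      (isAlgebraic_of_K₀ ((4 * tUK)⁻¹) (by push_cast; rfl)))
    (isSemialgebraicFunOn_betaFun (1 / 2) (1 / 4) (by norm_num) (by norm_num))

/-- `ν` is `ℚ`-semialgebraic on the line `(0,1)`. -/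
theorem sa_tetNu : IsSemialgebraicFunOn ℚ (line (Ioo (0:ℝ) 1)) (fun x : Fin 1 → ℝ => tetNu (x 0)) := by
  have hX := sa_coord mix_line_sa
  have hc : IsSemialgebraicFunOn ℚ (line (Ioo (0:ℝ) 1)) (fun _ : Fin 1 → ℝ => tU ^ 2) :=
    isSemialgebraicFunOn_const_of_isAlgebraic mix_line_sa isAlgebraic_tU_sq
  have h1 : IsSemialgebraicFunOn ℚ (line (Ioo (0:ℝ) 1)) (fun x : Fin 1 → ℝ => 1 - x 0) :=
    (isSemialgebraicFunOn_aeval mix_line_sa (1 - X 0 : MvPolynomial (Fin 1) ℚ)).congr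
      fun x _ => by simp
  have h1' : IsSemialgebraicFunOn ℚ (line (Ioo (0:ℝ) 1)) (fun _ : Fin 1 → ℝ => (1:ℝ)) :=
    isSemialgebraicFunOn_const_of_isAlgebraic mix_line_sa isAlgebraic_one
  refine (IsSemialgebraicFunOn.div (IsSemialgebraicFunOn.mul_holds hc hX)
    (IsSemialgebraicFunOn.add_holds h1' (IsSemialgebraicFunOn.mul_holds hc h1))
    fun x hx => ?_).congr fun x _ => ?_
  · exact (tetNu_den_pos (show x 0 ∈ Ioo (0:ℝ) 1 from hx).2).ne'
  · simp only [tetNu, Pi.mul_apply, Pi.add_apply]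

end SoloBlind

end Summit.KontsevichZagierPeriods.KontsevichZagierPeriods.Theorems
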